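import Mathlib
import Summits.ValiantsHypothesis.ValiantsHypothesis.Theorems.LacunarySymmetroidMatrixDescartesSignWordLaw
import Summits.ValiantsHypothesis.ValiantsHypothesis.Theorems.LacunarySymmetroidMatrixDescartesCensusFatSectors

/-!
# `MatrixDescartes` (stmt-ValiantsHypothesis-18050) — the dominated sign-word law in the crux's currency

HONEST FRAMING.  Cell `pub-symmetroid`, seat `val-sym-mdr-p2` (gen 5); helper file `--supports` the crux
`Theses.LacunarySymmetroid.MatrixDescartes`.  Bookkeeping corollaries of the SECTOR theorem `signWord_posRoots_le`
(`…SignWordLaw`: a semidefinite sign word with `α` alternations whose sign boundaries dominate a covering family of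
`α` scale windows has `Z₊ ≤ α·card ι`); nothing here bears on the crux in general, on `stub_twoSided`, on
`DoorA26` / `DoorA34`, or on `VP ≠ VNP`.

* `signWord_realRoots_le`: if all exponents have ONE PARITY, the reflected pencil `F(−X) = ∑ X^{dₗ}((−1)^{dₗ}Sₗ)`
  is `F` or `−F`, so the same window data bound its positive zeros and `det F` has at most `2·α·m + 1` distinct
  real zeros (tree `stub_negRoots`, `roots_det_pencil_neg`).
* `signWord_mdr`: in the regime `m ≤ 2^((⌊log₂K⌋+c)^c)` (and `α ≤ K`, automatic when the blocks `1, …, α` are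
  non-empty) this gives `Z^q ≤ 2^(K⌊log₂K⌋)` for all large `K` (tree `Census.fatFormat_absorb`) — the inequality
  of `MatrixDescartes` on this format family at every admissible size, fat formats included.  Nothing is claimed
  outside the family (in particular nothing without the dominance hypotheses: the tree's
  `DefiniteWitness.cameronPsarrakos_counterexample` has `6 > 2·2` at `α = 2`).
[folklore] Mathlib + tree lemmas; axioms `propext`, `Classical.choice`, `Quot.sound`.
-/

-- layout Summits/ValiantsHypothesis/ValiantsHypothesis forces the duplicated namespace component
set_option linter.dupNamespace false

namespace Summit.ValiantsHypothesis.ValiantsHypothesis.Theorems.LacunarySymmetroidMatrixDescartes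

open Polynomial Matrix Finset
open scoped BigOperators

/-- With exponents of one parity, the reflected pencil `∑ X^{dₗ}((−1)^{dₗ}Sₗ)` has the same positive zeros of its
determinant as `∑ X^{dₗ} Sₗ`. [folklore] -/
theorem posRoots_reflect_of_parity (K m : ℕ) (d : Fin K → ℕ) (S : Fin K → Matrix (Fin m) (Fin m) ℝ)
    (hpar : (∀ l, Even (d l)) ∨ (∀ l, Odd (d l))) :
    ((Matrix.det (∑ l, ((Polynomial.X : Polynomial ℝ) ^ d l) •
        (((-1 : ℝ) ^ d l) • S l).map Polynomial.C)).roots.toFinset.filter (fun t => 0 < t)).card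
      = ((Matrix.det (∑ l, ((Polynomial.X : Polynomial ℝ) ^ d l) • (S l).map Polynomial.C)
          ).roots.toFinset.filter (fun t => 0 < t)).card := by
  rcases hpar with hev | hod
  · have e : (∑ l, ((Polynomial.X : Polynomial ℝ) ^ d l) • (((-1 : ℝ) ^ d l) • S l).map Polynomial.C)
        = ∑ l, ((Polynomial.X : Polynomial ℝ) ^ d l) • (S l).map Polynomial.C :=
      Finset.sum_congr rfl fun l _ => by rw [(hev l).neg_one_pow, one_smul]
    rw [e]
  · have e : (∑ l, ((Polynomial.X : Polynomial ℝ) ^ d l) • (((-1 : ℝ) ^ d l) • S l).map Polynomial.C)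
        = ∑ l, ((Polynomial.X : Polynomial ℝ) ^ d l) • (-S l).map Polynomial.C :=
      Finset.sum_congr rfl fun l _ => by rw [(hod l).neg_one_pow, neg_smul, one_smul]
    rw [e, roots_det_pencil_neg]

/-- **Real zeros of a dominated sign word with exponents of one parity**: at most `2·α·m + 1` (data as in
`signWord_posRoots_le`; the reflected pencil is `±F`, so the same windows serve). [folklore] -/
theorem signWord_realRoots_le (K m : ℕ) (d : Fin K → ℕ) (hd : StrictMono d)
    (S : Fin K → Matrix (Fin m) (Fin m) ℝ) (hS : ∀ l, (S l).IsSymm)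
    (hpar : (∀ l, Even (d l)) ∨ (∀ l, Odd (d l)))
    (blk : Fin K → ℕ) (hblk : Monotone blk) (α : ℕ) (hα : 1 ≤ α) (hblkα : ∀ l, blk l ≤ α)
    (hsign : ∀ l, (((-1 : ℝ) ^ blk l) • S l).PosSemidef)
    (x : ℕ → ℝ) (hxmono : Monotone x) (hx0 : x 0 = 0) (hxpos : ∀ j, 1 ≤ j → 0 < x j)
    (π μ μ' : ℕ → Fin K)
    (hπB : ∀ j, j < α → ∀ l, l < π j → blk l ≤ j) (hπA : ∀ j, j < α → ∀ l, π j < l → j + 1 ≤ blk l)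
    (hμ : ∀ j, j < α → π j < μ j ∧ blk (μ j) = j + 1)
    (hμ' : ∀ j, 1 ≤ j → j < α → μ' j < π j ∧ blk (μ' j) = j)
    (hdomA : ∀ j, j + 1 < α →
      ((((d (μ j) - d (π j) : ℕ) : ℝ)) • (((-1 : ℝ) ^ blk (μ j)) • S (μ j))
        - ∑ l ∈ univ.filter (fun l => π j < l ∧ ¬ Odd (j + blk l)),
            (((d l - d (π j) : ℕ) : ℝ) * x (j + 1) ^ (d l - d (μ j))) • (((-1 : ℝ) ^ blk l) • S l)
        ).PosSemidef)
    (hdomB : ∀ j, 1 ≤ j → j < α →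
      ((((d (π j) - d (μ' j) : ℕ) : ℝ)) • (((-1 : ℝ) ^ blk (μ' j)) • S (μ' j))
        - ∑ l ∈ univ.filter (fun l => l < π j ∧ Odd (j + blk l)),
            (((d (π j) - d l : ℕ) : ℝ) * (x j)⁻¹ ^ (d (μ' j) - d l)) • (((-1 : ℝ) ^ blk l) • S l)
        ).PosSemidef) :
    (Matrix.det (∑ l, ((Polynomial.X : Polynomial ℝ) ^ d l) • (S l).map Polynomial.C)
      ).roots.toFinset.card ≤ 2 * α * m + 1 := by
  have h1 := signWord_posRoots_le (Fin m) d hd S hS blk hblk α hα hblkα hsign x hxmono hx0 hxpos π μ μ' hπB hπA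
    hμ hμ' hdomA hdomB
  have h2 := posRoots_reflect_of_parity K m d S hpar
  have h3 := stub_negRoots K m d S
  rw [Fintype.card_fin] at h1
  rw [h2] at h3
  calc (Matrix.det (∑ l, ((Polynomial.X : Polynomial ℝ) ^ d l) • (S l).map Polynomial.C)).roots.toFinset.card
      ≤ _ := h3
    _ ≤ α * m + α * m + 1 := by omega
    _ = 2 * α * m + 1 := by ring

/-- **The crux's inequality on dominated sign words, at every admissible size.**  For all `c, q` there is `K₀` such
that for all `K ≥ K₀`, all `m ≤ 2^((⌊log₂K⌋+c)^c)`, all strictly increasing exponents of one parity and all real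
symmetric letters forming a dominated sign word with `α ≤ K` alternations (data as in `signWord_posRoots_le`), the
number `Z` of distinct real zeros of `det (∑ₗ X^{dₗ} Sₗ)` satisfies `Z^q ≤ 2^(K⌊log₂K⌋)` — `MatrixDescartes`
restricted to this format family, fat formats included.  Nothing is claimed outside the family. [folklore] -/
theorem signWord_mdr (c q : ℕ) : ∃ K₀ : ℕ, ∀ K m : ℕ, K₀ ≤ K → m ≤ 2 ^ ((Nat.log 2 K + c) ^ c) →
    ∀ (d : Fin K → ℕ), StrictMono d → ((∀ l, Even (d l)) ∨ (∀ l, Odd (d l))) →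
    ∀ (S : Fin K → Matrix (Fin m) (Fin m) ℝ), (∀ l, (S l).IsSymm) →
    ∀ (blk : Fin K → ℕ), Monotone blk → ∀ (α : ℕ), 1 ≤ α → α ≤ K → (∀ l, blk l ≤ α) →
    (∀ l, (((-1 : ℝ) ^ blk l) • S l).PosSemidef) →
    ∀ (x : ℕ → ℝ), Monotone x → x 0 = 0 → (∀ j, 1 ≤ j → 0 < x j) →
    ∀ (π μ μ' : ℕ → Fin K),
    (∀ j, j < α → ∀ l, l < π j → blk l ≤ j) → (∀ j, j < α → ∀ l, π j < l → j + 1 ≤ blk l) →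
    (∀ j, j < α → π j < μ j ∧ blk (μ j) = j + 1) →
    (∀ j, 1 ≤ j → j < α → μ' j < π j ∧ blk (μ' j) = j) →
    (∀ j, j + 1 < α →
      ((((d (μ j) - d (π j) : ℕ) : ℝ)) • (((-1 : ℝ) ^ blk (μ j)) • S (μ j))
        - ∑ l ∈ univ.filter (fun l => π j < l ∧ ¬ Odd (j + blk l)),
            (((d l - d (π j) : ℕ) : ℝ) * x (j + 1) ^ (d l - d (μ j))) • (((-1 : ℝ) ^ blk l) • S l)
        ).PosSemidef) →
    (∀ j, 1 ≤ j → j < α →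
      ((((d (π j) - d (μ' j) : ℕ) : ℝ)) • (((-1 : ℝ) ^ blk (μ' j)) • S (μ' j))
        - ∑ l ∈ univ.filter (fun l => l < π j ∧ Odd (j + blk l)),
            (((d (π j) - d l : ℕ) : ℝ) * (x j)⁻¹ ^ (d (μ' j) - d l)) • (((-1 : ℝ) ^ blk l) • S l)
        ).PosSemidef) →
    (Matrix.det (∑ l, ((Polynomial.X : Polynomial ℝ) ^ d l) • (S l).map Polynomial.C)
      ).roots.toFinset.card ^ q ≤ 2 ^ (K * Nat.log 2 K) := by
  obtain ⟨K₀, hK₀⟩ := Census.fatFormat_absorb 1 c q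
  refine ⟨K₀, fun K m hK hm d hd hpar S hS blk hblk α hα hαK hblkα hsign x hxmono hx0 hxpos π μ μ' hπB hπA hμ
    hμ' hdomA hdomB => hK₀ K m _ hK hm ?_⟩
  have hZ := signWord_realRoots_le K m d hd S hS hpar blk hblk α hα hblkα hsign x hxmono hx0 hxpos π μ μ' hπB
    hπA hμ hμ' hdomA hdomB
  have h4 : 2 * α * m + 1 ≤ 2 ^ 1 * (m + 1) * (K + 1) := by
    have : α * m ≤ K * m := Nat.mul_le_mul_right m hαK
    nlinarith
  exact hZ.trans h4

end Summit.ValiantsHypothesis.ValiantsHypothesis.Theorems.LacunarySymmetroidMatrixDescartes
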